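import Literature.NumberTheory.EllipticCurves.Kato2004.EllipticUnitTatePairingValuesK
import Literature.NumberTheory.GaloisRepresentations.HeckeCharacterOfGrossencharakter
import HarnessLib

/-!
# Kato 2004 Prop. 15.9 / (15.9.1) on the local Tate pairing at the inert place (`CM.prop159_ellipticUnits_tatePairing_values_inert`)
# PINNED TO A GRÖSSENCHARAKTER GIVEN BY ITS VALUES ON PRIMES (`IsGrossencharakter`, Neukirch VII (6.1)/(6.14)) — the bridge
# `…_of_isGrossencharakter` (PROVED from the fact)

Topic `NumberTheory/EllipticCurves`, sub-directory `Kato2004`, namespace `…Kato2004.CM`. THEOREMS ONLY (kernel lane); no named fact, no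
definition, no instance, no `sorry`. Cell `pub/bsd-wall` / `bsd-inputs`, seat `bsd-inputs-honda-p1` g31, for crux L `SmallImageLowerHalfBothSigns`
(stmt-BirchSwinnertonDyer-23599), line `rtt_w3`, row S4‴, LEAD ruling «PIN = ψ» (2026-08-31): the S4‴ binders carry the CM form's Grössencharakter as
`ψ : HeightOneSpectrum (𝓞 K) → ℂ` with `IsGrossencharakter 𝔪 (embType σK) (embTypeConj σK) ψ` and pin `θ` by «Frobenius char-poly at `w ∤ p𝔪` is
`X − e⁻¹(ψ w)`», whereas the fact `prop159_ellipticUnits_tatePairing_values_inert` (file `EllipticUnitTatePairingValuesK.lean`, Kato's currency) speaks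
an idelic `HeckeCharacter` `ψH` with `ψH((α)) = σK(α)` for `α ≡ 1 (𝔣)`. This file derives the former shape from the latter with
`ψH := heckeOfGross h𝔪 hψ` (the tree's Hecke character of a Grössencharakter, Neukirch VII Cor. (6.14)): the infinity type
(`heckeOfGross_hasInfinityType`), the values `ψH(ϖ_w) = ψ(w)` off `𝔪` (`heckeOfGross_valueAtUniformizer`), hence `ψH(𝔞) = idealPow ψ 𝔞` for
`𝔞` prime to `𝔪`, and `ψH((α)) = σK(α)` for `α ≡ 1 (𝔪)` (`IsGrossencharakter.idealPow_span_eq` with `c = 1`; the total-positivity side condition is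
void because `K` is totally complex). HONEST FRAMING: a currency bridge; the fact itself stays a cite (XL); BSD / crux L / S4‴ are not advanced.

* §1 `idealPow_congr_of_isCoprime`, `heckeCharIdealValue_eq_idealPow_valueAtUniformizer`, `heckeCharIdealValue_heckeOfGross_eq_idealPow`,
  `heckeCharIdealValue_heckeOfGross_asIdeal`, `idealPow_span_singleton_eq_of_sub_one_mem` (`ψ((α)) = σK α` for `α ≡ 1 (𝔪)`, `K` totally complex).
* §2 ★ `prop159_ellipticUnits_tatePairing_values_inert_of_isGrossencharakter`.
References: [Kato2004Asterisque] §15.7, Prop. 15.9, (15.9.1); [NeukirchANT1999] VII §6 (6.1), (6.14).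
-/

noncomputable section

open scoped Classical NumberField ComplexConjugate
open NumberField IsDedekindDomain Field Polynomial CategoryTheory

namespace Literature.NumberTheory.EllipticCurves.Kato2004

namespace CM

open Literature.NumberTheory.EllipticCurves Literature.NumberTheory.EllipticCurves.AcSigned
  Literature.NumberTheory.EllipticCurves.Kobayashi2003
  Literature.NumberTheory.GaloisRepresentations Literature.NumberTheory.GaloisRepresentations.DiscreteGaloisModule
  Literature.NumberTheory.GaloisCohomology Literature.NumberTheory.LFunctions
  Literature.NumberTheory.ComplexMultiplication.EllipticUnits
  Literature.NumberTheory.ComplexMultiplication.EllipticUnits.JohnsonLeungKings2011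
  Literature.NumberTheory.EllipticCurves.Kato2004.LocalTate ZpExtension

/-! ## §1. Ideal values of the Hecke character of a Grössencharakter -/

section IdealValues

variable {K : Type} [Field K] [NumberField K]

/-- Two prime-value functions that agree off `𝔪` have the same ideal character on the ideals prime to `𝔪`
(`χ(𝔞) = ∏_𝔭 χ(𝔭)^{ν_𝔭(𝔞)}` only involves the primes dividing `𝔞`). [cite: NeukirchANT1999, Ch. VII §6 (6.1)] -/
theorem idealPow_congr_of_isCoprime {f g : HeightOneSpectrum (𝓞 K) → ℂ} {𝔪 I : Ideal (𝓞 K)}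
    (hfg : ∀ v : HeightOneSpectrum (𝓞 K), ¬ 𝔪 ≤ v.asIdeal → f v = g v) (hI : IsCoprime I 𝔪) :
    idealPow K f I = idealPow K g I := by
  unfold idealPow
  refine finprod_congr fun v => ?_
  by_cases hv : 𝔪 ≤ v.asIdeal
  · by_cases hI0 : I = ⊥
    · subst hI0
      have htop : 𝔪 = ⊤ := by
        have h := Ideal.isCoprime_iff_sup_eq.mp hI
        rwa [bot_sup_eq] at h
      exact absurd (htop ▸ hv) (fun h => v.isPrime.ne_top (top_le_iff.mp h))
    · have hcount : (Associates.mk v.asIdeal).count (Associates.mk I).factors = 0 := by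
        by_contra hc
        have hdvd : v.asIdeal ∣ I := (Associates.count_ne_zero_iff_dvd hI0 v.irreducible).mp hc
        have hle : I ⊔ 𝔪 ≤ v.asIdeal := sup_le (Ideal.le_of_dvd hdvd) hv
        rw [Ideal.isCoprime_iff_sup_eq.mp hI, top_le_iff] at hle
        exact v.isPrime.ne_top hle
      rw [hcount, pow_zero, pow_zero]
  · rw [hfg v hv]

/-- `CM.heckeCharIdealValue ψ I` IS the ideal character `idealPow K (ψ(ϖ_·)) I` for `I ≠ 0` (the tree's two multiplicity conventions agree,
`Ideal.count_associates_factors_eq`). [cite: Kato2004Asterisque, §15.7 (pp. 255–256)] -/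
theorem heckeCharIdealValue_eq_idealPow_valueAtUniformizer (ψ : HeckeCharacter K) {I : Ideal (𝓞 K)} (hI : I ≠ ⊥) :
    heckeCharIdealValue ψ I = idealPow K (fun v => ψ.valueAtUniformizer v) I := by
  classical
  rw [heckeCharIdealValue, if_neg hI, idealPow]
  refine finprod_congr fun v => ?_
  rw [Ideal.count_associates_factors_eq hI v.isPrime v.ne_bot]

variable {𝔪 : Ideal (𝓞 K)} {p q : InfinitePlace K → ℤ} {ψ : HeightOneSpectrum (𝓞 K) → ℂ}

/-- **`ψH(𝔞) = ψ(𝔞)` for `𝔞` prime to `𝔪`**, `ψH = heckeOfGross` the Hecke character of the Grössencharakter `ψ mod 𝔪`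
(`ψH(ϖ_w) = ψ(w)` off `𝔪`, Neukirch VII (6.14)). [cite: NeukirchANT1999, Ch. VII §6 Cor. (6.14)] [cite: Kato2004Asterisque, §15.7 (pp. 255–256)] -/
theorem heckeCharIdealValue_heckeOfGross_eq_idealPow (h𝔪 : 𝔪 ≠ ⊥) (hψ : IsGrossencharakter 𝔪 p q ψ) {I : Ideal (𝓞 K)}
    (hI : I ≠ ⊥) (hIc : IsCoprime I 𝔪) : heckeCharIdealValue (heckeOfGross h𝔪 hψ) I = idealPow K ψ I := by
  rw [heckeCharIdealValue_eq_idealPow_valueAtUniformizer _ hI]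
  exact idealPow_congr_of_isCoprime (fun v hv => heckeOfGross_valueAtUniformizer h𝔪 hψ hv) hIc

/-- **`ψH(𝔭_w) = ψ(w)` at a prime `w ∤ 𝔪`.** [cite: NeukirchANT1999, Ch. VII §6 Cor. (6.14)] -/
theorem heckeCharIdealValue_heckeOfGross_asIdeal (h𝔪 : 𝔪 ≠ ⊥) (hψ : IsGrossencharakter 𝔪 p q ψ) {w : HeightOneSpectrum (𝓞 K)}
    (hw : ¬ 𝔪 ≤ w.asIdeal) : heckeCharIdealValue (heckeOfGross h𝔪 hψ) w.asIdeal = ψ w := by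
  rw [heckeCharIdealValue_eq_idealPow_valueAtUniformizer _ w.ne_bot, idealPow_asIdeal]
  exact heckeOfGross_valueAtUniformizer h𝔪 hψ hw

/-- A totally complex field has no real embedding (every infinite place is complex). [cite: NeukirchANT1999, Ch. III §1] -/
theorem not_nonempty_ringHom_real_of_isTotallyComplex (K : Type) [Field K] [IsTotallyComplex K] (φ : K →+* ℝ) : False := by
  have hreal : ComplexEmbedding.IsReal (Complex.ofRealHom.comp φ) := by
    rw [ComplexEmbedding.isReal_iff]
    ext x
    rw [ComplexEmbedding.conjugate_coe_eq, RingHom.comp_apply, Complex.ofRealHom_eq_coe, Complex.conj_ofReal]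
  exact IsTotallyComplex.complexEmbedding_not_isReal _ hreal

/-- **`ψ((α)) = σK(α)` for `α ≡ 1 (mod 𝔪)`, `α ≠ 0`, for a Grössencharakter of type `(1, 0)` at `σK` of a TOTALLY COMPLEX field** (the ray condition
`IsGrossencharakter.idealPow_span_eq` at `c = 1`; there is no real embedding, so the positivity proviso is void; `∏_w σ_w(α)^{p_w} σ̄_w(α)^{q_w} = σK(α)`
by `prod_embedding_zpow_embType`). [cite: NeukirchANT1999, Ch. VII §6 Def. (6.1)] [cite: Kato2004Asterisque, §15.7–15.8 (pp. 255–256)] -/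
theorem idealPow_span_singleton_eq_of_sub_one_mem [IsTotallyComplex K] (σK : K →+* ℂ)
    (hψ : IsGrossencharakter 𝔪 (embType σK) (embTypeConj σK) ψ) {α : 𝓞 K} (hα : α ≠ 0) (hα1 : α - 1 ∈ 𝔪) :
    idealPow K ψ (Ideal.span {α}) = σK (α : K) := by
  have hcop : IsCoprime (Ideal.span {(1 : 𝓞 K)}) 𝔪 := by
    rw [Ideal.span_singleton_one]
    exact Ideal.isCoprime_iff_sup_eq.mpr (top_sup_eq _)
  have h := hψ.idealPow_span_eq α 1 hα one_ne_zero hcop hα1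
    (fun φ => (not_nonempty_ringHom_real_of_isTotallyComplex K φ).elim)
  rw [Ideal.span_singleton_one, idealPow_top, one_mul] at h
  rw [h]
  have h1 : ((α : 𝓞 K) : K) / ((1 : 𝓞 K) : K) = (α : K) := by
    rw [RingOfIntegers.coe_eq_algebraMap, RingOfIntegers.coe_eq_algebraMap, map_one, div_one]
  rw [h1]
  exact prod_embedding_zpow_embType σK (α : K)

end IdealValues

/-! ## §2. The fact pinned to `IsGrossencharakter` -/

set_option maxHeartbeats 1000000 in -- the instantiation of the 40-binder fact at `ψH` elaborates in ≈ 600k heartbeats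
/-- ★ **Kato 2004 Prop. 15.9 / (15.9.1) on the local Tate pairing at the inert place, FOR A GRÖSSENCHARAKTER GIVEN BY ITS PRIME VALUES** (LEAD ruling
«PIN = ψ»): granted `prop159_ellipticUnits_tatePairing_values_inert`, the SAME statement holds with the Hecke character replaced by S4‴'s own
`ψ : HeightOneSpectrum (𝓞 K) → ℂ`, `IsGrossencharakter 𝔪 (embType σK) (embTypeConj σK) ψ`, `𝔪 ≠ 0`, `𝔪 ∣ 𝔣`: the pin of `θ` reads «at every `w`
prime to `p𝔣`, `θ` is unramified with arithmetic-Frobenius characteristic polynomial `X − e⁻¹(ψ w)`» (the S4 prefix's clause), the twist factor of the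
value law is `N𝔞 − idealPow K ψ 𝔞 · χ(𝔞)⁻¹`, and the depleted series is that of `ψH = heckeOfGross h𝔪 hψ`. Proof: instantiate the fact at `ψH`
(`heckeOfGross_hasInfinityType`; `ψH((α)) = σK(α)` for `α ≡ 1 (𝔣) ⊆ (𝔪)` by §1) and rewrite `ψH(𝔭_w) = ψ(w)`, `ψH(𝔞) = idealPow ψ 𝔞` (§1).
[cite: Kato2004Asterisque, Prop. 15.9 and (15.9.1) (pp. 258–259), §15.7–15.8 (pp. 255–258)] [cite: NeukirchANT1999, Ch. VII §6 Cor. (6.14)] -/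
theorem prop159_ellipticUnits_tatePairing_values_inert_of_isGrossencharakter (hF : prop159_ellipticUnits_tatePairing_values_inert) :

  ∀ (K : Type) [Field K] [NumberField K] (σK : K →+* ℂ), Module.finrank ℚ K = 2 → IsTotallyComplex K →
  ∀ (p : ℕ) [Fact p.Prime], p ≠ 2 →
  ∀ (v : HeightOneSpectrum (𝓞 K)), v.asIdeal = Ideal.span {((p : ℕ) : 𝓞 K)} → ∀ (hpv : ((p : ℕ) : 𝓞 K) ∈ v.asIdeal),
  ∀ (κ : ZpExtension K p), κ.IsCyclotomic → ∀ (hvns : IsNonsplitIn κ v),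
  ∀ (γv : absoluteGaloisGroup (v.adicCompletion K)), (localizeAt κ v hvns).IsTopGenerator γv →
  -- S4‴'s OWN Grössencharakter: values `ψ` on primes, `IsGrossencharakter 𝔪 …` of type `(1,0)` at `σK`; the modulus `𝔣`: `𝔪 ∣ 𝔣`, `𝒪_K^× ↪ (𝒪_K/𝔣)^×`
  ∀ (𝔪 : Ideal (𝓞 K)) (h𝔪 : 𝔪 ≠ ⊥) (ψ : HeightOneSpectrum (𝓞 K) → ℂ) (hψ : IsGrossencharakter 𝔪 (embType σK) (embTypeConj σK) ψ),
  ∀ (𝔣 : Ideal (𝓞 K)), 𝔣 ≠ ⊥ → (∀ u : (𝓞 K)ˣ, (u : 𝓞 K) - 1 ∈ 𝔣 → u = 1) →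
    𝔪 ∣ 𝔣 →
  -- the coefficients `𝒪_S ⊂ F_S = ℚ_p(S)`, the character `θ` (the `λ`-adic avatar of `ψ`: ARITHMETIC Frobenius at `w ∤ p𝔣` acts by `ψ(w)`, read through `e`) and its inverse `θ′`
  ∀ (S : Set (PadicAlgCl p)), FiniteDimensional ℚ_[p] (padicCoeffField S) →
  ∀ (θ : FramedGaloisRep K (padicCoeffIntegers S) 1) (θ' : absoluteGaloisGroup K →ₜ* (padicCoeffIntegers S)ˣ),
    (∀ g : absoluteGaloisGroup K, ((θ' g : (padicCoeffIntegers S)ˣ) : padicCoeffIntegers S) *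
      ((θ g : GL (Fin 1) (padicCoeffIntegers S)) : Matrix (Fin 1) (Fin 1) (padicCoeffIntegers S)) 0 0 = 1) →
  ∀ (e : PadicAlgCl p ≃+* ℂ),
    (∀ w : HeightOneSpectrum (𝓞 K), IsCoprime w.asIdeal (katoModulus p 𝔣 1) →
      θ.IsUnramifiedAt w ∧ ∃ P : Polynomial (padicCoeffIntegers S),
        P.map (padicCoeffIntegers S).subtype = Polynomial.X - Polynomial.C (e.symm (ψ w)) ∧ θ.HasFrobCharpolyAt w P) →
  -- the frames: a complex embedding `ιC` of `K̄` extending `σK` (pinning the elliptic units) and a `p`-adic frame `Φ` of `K̄_v` over `ℚ_p → K_v`, COHERENT with `ιC`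
  -- through `e` on the cyclotomic tower `K_∞ = K̄^{ker κ}`
  ∀ (ιC : AlgebraicClosure K →+* ℂ), (∀ x : K, ιC (algebraMap K (AlgebraicClosure K) x) = σK x) →
  ∀ (Φ : AlgebraicClosure (v.adicCompletion K) →+* PadicAlgCl p),
    (letI := LocalField.adicCompletionPadicAlgebra v p hpv
     ∀ y : ℚ_[p], Φ (algebraMap (v.adicCompletion K) (AlgebraicClosure (v.adicCompletion K)) (algebraMap ℚ_[p] (v.adicCompletion K) y)) =
       algebraMap ℚ_[p] (PadicAlgCl p) y) →
    (∀ x : AlgebraicClosure K, (∀ σ ∈ κ.kerSubgroup, σ • x = x) →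
      e (Φ (closureEmb (K := K) (v.adicCompletion K) x)) = ιC x) →
  -- the curve `W/ℚ` (good supersingular at `p`, `a_p = 0`), the discrete module `M = (F_S/𝒪_S)(θ)` with its local action pinned to `res_v`, and the reading map `j`
  ∀ (W : WeierstrassCurve ℚ) [W.IsElliptic] [W.IsGloballyMinimal], W.HasGoodReductionAtPrime p → W.frobeniusTrace p = 0 →
  ∀ [DistribMulAction (absoluteGaloisGroup (v.adicCompletion K)) (GreenbergSelmer.Cofree θ (padicCoeffField S))]
    (hres : ∀ (σ : absoluteGaloisGroup (v.adicCompletion K)) (m : GreenbergSelmer.Cofree θ (padicCoeffField S)),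
      σ • m = resGalOfEmb (closureEmb (K := K) (v.adicCompletion K)) σ • m)
    (hstab : ∀ m : GreenbergSelmer.Cofree θ (padicCoeffField S),
      IsOpen (MulAction.stabilizer (absoluteGaloisGroup (v.adicCompletion K)) m : Set (absoluteGaloisGroup (v.adicCompletion K))))
    (j : (W.baseChange K).geomPrimaryTorsion p →+ GreenbergSelmer.Cofree θ (padicCoeffField S)),
    (∀ (δ : absoluteGaloisGroup (v.adicCompletion K)) (t : (W.baseChange K).geomPrimaryTorsion p),
      j (resGalOfEmb (closureEmb (K := K) (v.adicCompletion K)) δ • t) = resGalOfEmb (closureEmb (K := K) (v.adicCompletion K)) δ • j t) →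
    Submodule.span (padicCoeffIntegers S) (Set.range j) = ⊤ →
  ∃ (Ω : ℂ) (av : v.adicCompletion K) (aS : padicCoeffField S), Ω ≠ 0 ∧ av ≠ 0 ∧ aS ≠ 0 ∧
  ∀ (𝔞 : Ideal (𝓞 K)), IsCoprime 𝔞 (katoModulus6 p 𝔣) → ∀ (n : ℕ), ∃ Y : ℕ → PadicAlgCl p,
    -- (V) THE VALUE LAW (15.9.1): the character sums of the coordinates `Y_m = (ι ⊗ Φγ_v^m)(y_n)` are the depleted `L`-values
    (∀ (χ : absoluteGaloisGroup K →ₜ* ℂˣ), (∀ σ ∈ κ.layerSubgroup n, χ σ = 1) →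
      ∀ L : ℂ → ℂ, IsDepletedHeckeLIdeal (heckeOfGross h𝔪 hψ) χ (katoModulus p 𝔣 1) L →
        ∑ m ∈ Finset.range (p ^ n),
            ((χ (resGalOfEmb (closureEmb (K := K) (v.adicCompletion K)) γv) : ℂˣ) : ℂ) ^ m * e (Y m) =
          (((Ideal.absNorm 𝔞 : ℕ) : ℂ) - LFunctions.idealPow K ψ 𝔞 * (heckeIdealValue χ 𝔞)⁻¹) * Ω⁻¹ * L 1) ∧
    -- (P) THE PAIRING LAW at every torsion exponent `k` and every large Kato level `s`
    (∀ (k : ℕ), ∃ s₀ : ℕ, ∀ (s : ℕ), s₀ ≤ s → ∀ (hle : katoLevelSubgroup p 𝔣 s ≤ κ.layerSubgroup n)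
      (u β : (AlgebraicClosure K)ˣ) (c : levelCohO S (suppPF p 𝔣) θ' (katoLevelSubgroup p 𝔣 s) k 1),
      IsKatoUnitRepAt p ιC 𝔣 s 𝔞 u → β ^ (p ^ k) = u⁻¹ → IsTwistedKummerClassO S θ' (suppPF p 𝔣) (katoLevelSubgroup p 𝔣 s) k β c →
      ∀ [IsClosed ((localSubgroupOfEmb (κ.layerSubgroup n) (closureEmb (K := K) (v.adicCompletion K)) :
          Subgroup (absoluteGaloisGroup (v.adicCompletion K))) : Set (absoluteGaloisGroup (v.adicCompletion K)))]
        [Fintype (absoluteGaloisGroup (v.adicCompletion K) ⧸ localSubgroupOfEmb (κ.layerSubgroup n) (closureEmb (K := K) (v.adicCompletion K)))]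
        (lam : padicCoeffIntegers S →+ ℤ_[p]), (∀ (c : ℤ_[p]) (y : padicCoeffIntegers S), lam (padicIntToCoeffIntegers S c * y) = c * lam y) →
      ∀ (Pk : ContPairing (locCoeffRep S θ' (suppPF p 𝔣) v k).toTopRep (torsRep (GreenbergSelmer.Cofree θ (padicCoeffField S)) p hstab k).toTopRep
          (muAt K (p ^ k) v).toTopRep),
        (∀ (x : ↥(Representation.invariants ((muTwistO S θ' k).toRepresentation.comp (ramificationSubgroup K (suppPF p 𝔣)).subtype)))
            (a : padicCoeffIntegers S) (ζ : MuCarrier K (p ^ k)), (x : OMuCarrier K S (p ^ k)) = OMuCarrier.tmul a ζ →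
            ∀ t : Fin 1 → padicCoeffIntegers S,
              Pk.toLin x (divPowTors S K θ k t) = zmodSMulMu K (p ^ k) ζ (lamZMod S lam k (a * t 0))) →
      ∀ (Q' Q : localPoints (W.baseChange K) (v.adicCompletion K)),
        Q' ∈ localLayerPointsOfEmb κ (closureEmb (K := K) (v.adicCompletion K)) (W.baseChange K) n →
        Q' ∈ (W.baseChange K).localKernelOfReduction v → p ^ k • Q = Q' →
      ∀ (r : padicCoeffIntegers S)
        (φ : contOneCocycles (discreteTopRep (localSubgroupOfEmb (κ.layerSubgroup n) (closureEmb (K := K) (v.adicCompletion K)))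
          ↥(torsionPow (GreenbergSelmer.Cofree θ (padicCoeffField S)) p k))),
        (∀ (τ : localSubgroupOfEmb (κ.layerSubgroup n) (closureEmb (K := K) (v.adicCompletion K))) (t : (W.baseChange K).geomPrimaryTorsion p),
          pointsMapOfEmb (W.baseChange K) (closureEmb (K := K) (v.adicCompletion K)) (t : (W.baseChange K).geomPoints) =
              (τ : absoluteGaloisGroup (v.adicCompletion K)) • Q - Q →
            ((φ.1 τ : ↥(torsionPow (GreenbergSelmer.Cofree θ (padicCoeffField S)) p k)) : GreenbergSelmer.Cofree θ (padicCoeffField S)) = r • j t) →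
      ∃ t : padicCoeffIntegers S,
        (haveI : NeZero (p ^ k) := ⟨pow_ne_zero _ (Fact.out : p.Prime).ne_zero⟩
         localPairingSubgroup K (p ^ k) v (locCoeffRep S θ' (suppPF p 𝔣) v k) (torsRep (GreenbergSelmer.Cofree θ (padicCoeffField S)) p hstab k) Pk
            (localSubgroupOfEmb (κ.layerSubgroup n) (closureEmb (K := K) (v.adicCompletion K)))
            (locNK S κ θ' (suppPF p 𝔣) v n k
              (relCoresO S (suppPF p 𝔣) θ' hle (κ.isOpen_layerSubgroup n) (isOpen_absGaloisFixingSubgroup K (katoLayer p 𝔣 s)) k 1 c))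
            (oneCocycleClass _ φ) = PadicInt.toZModPow k (lam (r * t))) ∧
        (t : PadicAlgCl p) =
          Φ (algebraMap (v.adicCompletion K) (AlgebraicClosure (v.adicCompletion K)) av) * ((aS : padicCoeffField S) : PadicAlgCl p) *
            ∑ m ∈ Finset.range (p ^ n), Y m *
              (∑' i : ℕ, algebraMap ℚ_[p] (PadicAlgCl p) (PowerSeries.coeff i (W.map (algebraMap ℚ ℚ_[p])).formalLog) *
                Φ (WeierstrassCurve.Affine.Point.zCoord
                  (show ((W.baseChange K).baseChange (AlgebraicClosure (v.adicCompletion K))).toAffine.Point from (γv ^ m) • Q')) ^ i)) := by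
  intro K _ _ σK hK2 htc p _ hp v hv hpv κ hκ hvns γv hγv 𝔪 h𝔪 ψ hψ 𝔣 h𝔣 hunits h𝔪𝔣 S hS θ θ' hθ'θ e hpin ιC hιC Φ hΦ hcoh
    W _ _ hgood hap _ hres hstab j hj hspan
  haveI : IsTotallyComplex K := htc
  have h𝔣𝔪 : 𝔣 ≤ 𝔪 := Ideal.le_of_dvd h𝔪𝔣
  -- (i) the infinity type of `ψH`
  have hinf := heckeOfGross_hasInfinityType h𝔪 hψ
  -- (ii) `ψH((α)) = σK(α)` for `α ≡ 1 (𝔣)`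
  have hα : ∀ α : 𝓞 K, α ≠ 0 → α - 1 ∈ 𝔣 → heckeCharIdealValue (heckeOfGross h𝔪 hψ) (Ideal.span {α}) = σK (α : K) := by
    intro α hα0 hα1
    have hα1' : α - 1 ∈ 𝔪 := h𝔣𝔪 hα1
    have hcop : IsCoprime (Ideal.span {α}) 𝔪 := by
      rw [Ideal.isCoprime_iff_exists]
      refine ⟨α, Ideal.mem_span_singleton_self α, -(α - 1), 𝔪.neg_mem hα1', by ring⟩
    rw [heckeCharIdealValue_heckeOfGross_eq_idealPow h𝔪 hψ (by rwa [Ne, Ideal.span_singleton_eq_bot]) hcop]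
    exact idealPow_span_singleton_eq_of_sub_one_mem σK hψ hα0 hα1'
  -- (iii) the pin of `θ`, read through `ψH(𝔭_w) = ψ(w)`
  have hpin' : ∀ w : HeightOneSpectrum (𝓞 K), IsCoprime w.asIdeal (katoModulus p 𝔣 1) →
      θ.IsUnramifiedAt w ∧ ∃ P : Polynomial (padicCoeffIntegers S),
        P.map (padicCoeffIntegers S).subtype =
            Polynomial.X - Polynomial.C (e.symm (heckeCharIdealValue (heckeOfGross h𝔪 hψ) w.asIdeal)) ∧
          θ.HasFrobCharpolyAt w P := by
    intro w hw
    have hw𝔪 : ¬ 𝔪 ≤ w.asIdeal := by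
      intro hle
      have h1 : katoModulus p 𝔣 1 ≤ w.asIdeal := by
        rw [katoModulus]
        exact Ideal.mul_le_left.trans (h𝔣𝔪.trans hle)
      have h2 := Ideal.isCoprime_iff_sup_eq.mp hw
      rw [sup_eq_left.mpr h1] at h2
      exact w.isPrime.ne_top h2
    rw [heckeCharIdealValue_heckeOfGross_asIdeal h𝔪 hψ hw𝔪]
    exact hpin w hw
  obtain ⟨Ω, av, aS, hΩ, hav, haS, hmain⟩ :=
    hF K σK hK2 htc p hp v hv hpv κ hκ hvns γv hγv (heckeOfGross h𝔪 hψ) hinf 𝔣 h𝔣 hunits hα S hS θ θ' hθ'θ e hpin' ιC hιC Φ hΦ hcoh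
      W hgood hap hres hstab j hj hspan
  refine ⟨Ω, av, aS, hΩ, hav, haS, fun 𝔞 h𝔞 n => ?_⟩
  obtain ⟨Y, hV, hP⟩ := hmain 𝔞 h𝔞 n
  refine ⟨Y, fun χ hχ L hL => ?_, hP⟩
  -- (iv) `ψH(𝔞) = idealPow ψ 𝔞` for `𝔞` prime to `6p𝔣 ⊆ 𝔪`
  have h𝔞𝔪 : IsCoprime 𝔞 𝔪 := by
    refine Ideal.isCoprime_iff_sup_eq.mpr (top_le_iff.mp ?_)
    rw [← Ideal.isCoprime_iff_sup_eq.mp h𝔞]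
    refine sup_le_sup_left ?_ 𝔞
    rw [katoModulus6]
    exact Ideal.mul_le_left.trans h𝔣𝔪
  have h𝔞0 : 𝔞 ≠ ⊥ := by
    rintro rfl
    have h := Ideal.isCoprime_iff_sup_eq.mp h𝔞
    rw [bot_sup_eq, katoModulus6] at h
    have hle : Ideal.span {((6 * p : ℕ) : 𝓞 K)} * 𝔣 ≤ v.asIdeal := by
      refine Ideal.mul_le_right.trans ((Ideal.span_singleton_le_iff_mem _).mpr ?_)
      rw [Nat.cast_mul]
      exact v.asIdeal.mul_mem_left _ hpv
    rw [h, top_le_iff] at hle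
    exact v.isPrime.ne_top hle
  rw [← heckeCharIdealValue_heckeOfGross_eq_idealPow h𝔪 hψ h𝔞0 h𝔞𝔪]
  exact hV χ hχ L hL

end CM

end Literature.NumberTheory.EllipticCurves.Kato2004

end
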